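import Literature.Analysis.Complex.SimplyConnectedOfCompl
import Literature.Probability.RandomPlanarGeometry.PlanarDomains
import HarnessLib

/-!
# Jordan domains are simply connected: discharge of `Literature.Probability.RandomPlanarGeometry.JordanDomain.isSimplyConnected`

`Literature/Probability/RandomPlanarGeometry/PlanarDomains.lean` records as the named fact
`Literature.JordanDomain.isSimplyConnected D : Prop := IsSimplyConnected D.carrier` that a Jordan domain
(a bounded connected open set `D ⊆ ℂ` whose frontier is the trace of a simple closed curve) is
simply connected, citing the Jordan–Schoenflies theorem. This file **proves** it, without
Jordan–Schoenflies and without the Jordan curve theorem, by complex analysis (Conway's Theorem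
VIII.2.2, (c) ⇒ (a), `Literature.Analysis.Complex.SimplyConnectedOfCompl`):

* the frontier `∂D = range D.boundary` is connected (continuous image of `ℝ`), hence
  (`Complex.isPreconnected_compl_of_frontier`) `ℂ \ D` is connected; as `D` is bounded, `ℂ \ D`
  is the unique, unbounded, component of the complement ("`ℂ∞ \ D` is connected");
* so every holomorphic function on `D` is a locally uniform limit of polynomials (Runge,
  Conway VIII.1.15), has primitives, zero-free ones have logarithms and square roots
  (Conway VIII.2.2 (c) ⇒ (h), `Literature.Analysis.Complex.HolomorphicPrimitives`), and by the
  Riemann mapping theorem in the form of Conway's Lemma VII.4.3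
  (`Complex.exists_bijOn_ball_of_hasSqrt`, `Literature.Analysis.Complex.RiemannMapping`) `D` is
  homeomorphic to the unit disc, hence simply connected.

Only injectivity of the boundary loop is *not* used: any bounded domain whose frontier is a
continuous image of a connected space is simply connected.

## Main results

* `Literature.Probability.RandomPlanarGeometry.JordanDomain.isPreconnected_frontier`, `Literature.Probability.RandomPlanarGeometry.JordanDomain.isPreconnected_compl`;
* `Literature.JordanDomain.isSimplyConnected_holds : ∀ D : JordanDomain, D.isSimplyConnected`.

## References

* J. B. Conway, *Functions of One Complex Variable I*, 2nd ed., GTM 11, Springer (1978),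
  Thm. VIII.2.2 ((c) ⇒ (a)), p. 202–204.
* W. Werner, *Lectures on two-dimensional critical percolation*, IAS/Park City (2007), §2
  (Jordan domains).
-/

noncomputable section

open Set Topology

namespace Literature.Probability.RandomPlanarGeometry.JordanDomain

/-- The frontier of a Jordan domain is connected: it is the range of the (continuous) boundary
loop. Werner (2007), §2. [folklore] -/
theorem isPreconnected_frontier (D : JordanDomain) : IsPreconnected (frontier D.carrier) := by
  rw [← D.range_boundary]
  exact isPreconnected_range D.continuous_boundary

/-- The complement `ℂ \ D` of a Jordan domain is connected (`Complex.isPreconnected_compl_of_frontier`: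
an open set with connected frontier has connected complement). Conway (1978), Thm. VIII.2.2 (c).
[cite: Conway1978, Ch. VIII Thm. 2.2] -/
theorem isPreconnected_compl (D : JordanDomain) : IsPreconnected D.carrierᶜ :=
  Complex.isPreconnected_compl_of_frontier D.isOpen D.isPreconnected_frontier

/-- **Jordan domains are simply connected** (`Literature.Probability.RandomPlanarGeometry.JordanDomain.isSimplyConnected` holds), by
Conway's Theorem VIII.2.2, (c) ⇒ (a): `D` is open, connected and bounded with connected
complement, so (Runge ⇒ primitives ⇒ square roots ⇒ Riemann map onto the disc) it is simply
connected (`Complex.isSimplyConnected_of_isPreconnected_frontier`). This replaces the appeal to the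
Jordan–Schoenflies theorem in the fact's docstring. Conway, *Functions of One Complex Variable I*
(1978), Thm. VIII.2.2. [cite: Conway1978, Ch. VIII Thm. 2.2 ((c)⇒(a))] -/
theorem isSimplyConnected_holds (D : JordanDomain) : D.isSimplyConnected :=
  Complex.isSimplyConnected_of_isPreconnected_frontier D.isOpen D.isConnected D.isBounded
    D.isPreconnected_frontier

/-- Pointed form of `isSimplyConnected_holds`: the carrier of a Jordan domain is a simply
connected subset of `ℂ`. [cite: Conway1978, Ch. VIII Thm. 2.2 ((c)⇒(a))] -/
theorem isSimplyConnected_carrier (D : JordanDomain) : IsSimplyConnected D.carrier :=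
  D.isSimplyConnected_holds

end Literature.Probability.RandomPlanarGeometry.JordanDomain

end
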